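import Summits.BirchSwinnertonDyer.BirchSwinnertonDyer.Theorems.AlignedTransportAtTwoMainConjectureOfRankZeroBSDAtTwoSexticNormRelationDescentSignFreeIff
import Summits.BirchSwinnertonDyer.BirchSwinnertonDyer.Theorems.AlignedTransportAtTwoMainConjectureOfRankZeroBSDAtTwoSexticNormRelationDescentSignFreeOneRoot
import Summits.BirchSwinnertonDyer.BirchSwinnertonDyer.Theorems.AlignedTransportAtTwoMainConjectureOfRankZeroBSDAtTwoSexticLambdaKuroda
import Literature.NumberTheory.IwasawaTheory.ClassicalMuVanishesRealQuadraticTwo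
import HarnessLib

/-!
# Route `AlignedTransportAtTwo`, crux C2 `MainConjectureOfRankZeroBSDAtTwo` (stmt-BirchSwinnertonDyer-22298):
# THE RESOLVENT INPUT IS FREE FOR BOTH SIGNS OF `Δ_W` — `μ₂(ℚ(√Δ_W)^{cyc}) = 0` unconditionally; the sign-free `μ`-equivalence
# `μ₂(ℚ(W[2])) = 0 ⟺ μ₂(ℚ(β)) = 0` and the sign-free `S₃` Kuroda `λ`-identity `λ₂(ℚ(W[2])) = λ₂(ℚ(√Δ_W)) + 2·λ₂(ℚ(β))`

HONEST FRAMING. WIDTH-5 attached prover seat `bsd-line-att-p3` g34 on line `birth` of the lead `bsd-line-att-p2`; `--supports`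
stmt-BirchSwinnertonDyer-22298, closes nothing; BSD is NOT proved; crux C2, its verdict «blocked-on `Rank1Residual.GreenbergMuConjectureIrreducible`»
and every registered stub untouched. THEOREMS ONLY (no `def`, no named fact, no `sorry`).

WHAT. The sign-free `S₃` norm-relation descent of att-p4 g29 (`…SexticNormRelationDescentSignFree{,Mu,Iff,OneRoot}`) prices `μ₂(ℚ(W[2])^{cyc}) = 0` as
`μ₂ = 0` on the cubic towers `ℚ(β_j)` AND on the resolvent tower `ℚ(√Δ_W)` (hypothesis `hk`), and discharges `hk` only for `Δ_W < 0` (imaginary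
quadratic resolvent, Kida/Ferrero genus theory in the tree). This file discharges `hk` for BOTH signs: by the new Literature theorem
`classicalMuVanishes_of_finrank_eq_two` (`μ₂ = 0` for EVERY quadratic number field and every cyclotomic `ℤ₂`-extension — the real case by Chevalley's
formula with archimedean factor `1` in the totally real towers `ℚ_n(√d)/ℚ_n`, this seat's `ClassicalMuVanishesRealQuadraticTwo`), the resolvent
`ℚ(4δ₀)` (`(4δ₀)² = Δ_W ∉ ℚ²`) being quadratic.

* §1 ★ `classicalMuVanishes_resolvent_of_not_isSquare` — **`μ₂(ℚ(√Δ_W)^{cyc}) = 0` for every elliptic `W/ℚ` with `Δ_W ∉ ℚ²`, BOTH signs**.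
* §2 ★★ `classicalMuVanishes_divisionField_two_iff_cubic_of_not_isSquare` — `W(ℚ)[2] = 0`, `Δ_W ∉ ℚ²`, `2Δ_W ∉ ℚ²` (both signs):
  **`μ₂(ℚ(W[2])^{cyc}) = 0 ⟺ μ₂(ℚ(β_j)^{cyc}) = 0` for all `j`** ⟺ for ONE `j` (`…_iff_single_cubic_of_not_isSquare`); the `⟸` directions
  `classicalMuVanishes_divisionField_two_of_cubic_of_not_isSquare` / `…_of_single_cubic_of_not_isSquare` (g29's theorems with `hk` gone).
* §3 on C2's own binders (`W` globally minimal, good ordinary at `2`, no rational `2`-torsion abscissa, `Δ_W ∉ ℚ²`; `2Δ_W ∉ ℚ²` is automatic):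
  `classicalMuVanishes_resolvent_of_isOrdinaryAt`, ★★ `classicalMuVanishes_divisionField_two_iff_single_cubic_of_isOrdinaryAt`,
  `classicalMuVanishes_divisionField_two_of_single_cubic_of_isOrdinaryAt` — the PFμ⁺ middle field `ℚ(W[2])` (Lim's carrier) has `μ₂ = 0` iff ONE
  cubic point field `ℚ(β)` has, on the ENTIRE domain of the crux; the resolvent lane of the C2 input ledger is CLOSED for both signs.
* §4 ★ `exists_symmetricThree_gal_of_not_isSquare` (sign-free `S₃`-pair of `Gal(ℚ(W[2])/ℚ)`) and ★★
  `classicalLambda_divisionField_two_eq_resolvent_add_two_mul_cubic_of_not_isSquare` — g33's `S₃` Kuroda `λ`-identity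
  **`λ₂(ℚ(W[2])) = λ₂(ℚ(√Δ_W)) + 2·λ₂(ℚ(β))`** for BOTH signs of `Δ_W`, granted `μ₂ = 0` on ONE cubic tower (the resolvent `μ`-input and
  the other two cubic towers are now theorems); `…_of_isOrdinaryAt` on C2's binders. On `Δ_W > 0` all three fields are totally real and
  Greenberg's conjecture predicts every `λ₂` here to vanish; nothing of that is claimed.

References: [Iwasawa1973MuInvariants] Thm. 2/3, §3; [Washington1997] §13.1, §13.3 Prop. 13.22–13.23; [BiasseEtAl2022] Prop. 3.7; [Bartel2012] Thm. 1.2;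
[Greenberg1976TotallyReal]; tree: att-p4 g28/g29 `…SexticNormRelationDescent*`, att-p3 g33 `…SexticLambdaKuroda`, `IwasawaTheory.SymmetricThreeTowerLambda`,
this seat's `ClassicalMuVanishesQuadraticAscentUnramified` / `ClassicalMuVanishesRealQuadraticTwo`.
-/

set_option linter.dupNamespace false
set_option autoImplicit false

noncomputable section

open scoped Classical NumberField

namespace Summit.BirchSwinnertonDyer.BirchSwinnertonDyer.Theorems.AlignedTransportAtTwoResolventMuUnconditional

open NumberField Polynomial WeierstrassCurve IntermediateField Field
  Literature.NumberTheory.EllipticCurves Literature.NumberTheory.EllipticCurves.Greenberg1999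
  Literature.NumberTheory.EllipticCurves.DokchitserDokchitser2012
  Literature.NumberTheory.EllipticCurves.ZpExtension Literature.NumberTheory.GaloisRepresentations
  Literature.NumberTheory.IwasawaTheory Literature.NumberTheory.NumberFields
  Summit.BirchSwinnertonDyer.BirchSwinnertonDyer.Theorems.AlignedTransportAtTwoFineRoad.DivisionCubic
  Summit.BirchSwinnertonDyer.BirchSwinnertonDyer.Theorems.AlignedTransportAtTwoFineRoad.TowerImageDelta
  Summit.BirchSwinnertonDyer.BirchSwinnertonDyer.Theorems.AlignedTransportAtTwoCubicClosureParity
  Summit.BirchSwinnertonDyer.BirchSwinnertonDyer.Theorems.AlignedTransportAtTwoSexticTowerGrowth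
  Summit.BirchSwinnertonDyer.BirchSwinnertonDyer.Theorems.AlignedTransportAtTwoSexticNormRelationDescent
  Summit.BirchSwinnertonDyer.BirchSwinnertonDyer.Theorems.AlignedTransportAtTwoSexticNormRelationDescentMu
  Summit.BirchSwinnertonDyer.BirchSwinnertonDyer.Theorems.AlignedTransportAtTwoSexticNormRelationDescentSignFree
  Summit.BirchSwinnertonDyer.BirchSwinnertonDyer.Theorems.AlignedTransportAtTwoSexticNormRelationDescentSignFreeMu
  Summit.BirchSwinnertonDyer.BirchSwinnertonDyer.Theorems.AlignedTransportAtTwoSexticNormRelationDescentSignFreeIff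
  Summit.BirchSwinnertonDyer.BirchSwinnertonDyer.Theorems.AlignedTransportAtTwoSexticNormRelationDescentSignFreeOneRoot
  Summit.BirchSwinnertonDyer.BirchSwinnertonDyer.Theorems.AlignedTransportAtTwoSexticLambdaKuroda

variable (W : WeierstrassCurve ℚ) [W.IsElliptic]

/-! ## §1 The resolvent `μ`-input is free for both signs -/

/-- ★ **`μ₂(ℚ(√Δ_W)^{cyc}) = 0`, BOTH SIGNS, unconditionally**: for every elliptic `W/ℚ` with `Δ_W ∉ ℚ²` and every cyclotomic `ℤ₂`-extension `κk`
of the resolvent model `ℚ(4δ₀) ⊆ ℚ̄` (`(4δ₀)² = Δ_W`), `ClassicalMuVanishes κk` — `ℚ(4δ₀)` is a quadratic field (`finrank_adjoin_eq_two_of_sq_eq`) and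
`μ₂ = 0` for every quadratic field (`classicalMuVanishes_of_finrank_eq_two`: genus theory in `ℚ_n(√Δ)/ℚ_n`, archimedean factor `1` when
`Δ_W > 0`; the CM tower when `Δ_W < 0`). Supersedes `…SignFreeIff.classicalMuVanishes_resolvent_of_Δ_neg`. -/
theorem classicalMuVanishes_resolvent_of_not_isSquare (hsq : ¬ IsSquare W.Δ)
    (κk : ZpExtension ↥ℚ⟮4 * delta W two_ne_zero⟯ 2) (hκk : κk.IsCyclotomic) : ClassicalMuVanishes κk := by
  haveI : FiniteDimensional ℚ ↥ℚ⟮4 * delta W two_ne_zero⟯ :=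
    IntermediateField.adjoin.finiteDimensional ((AlgebraicClosure.isAlgebraic ℚ).isAlgebraic _).isIntegral
  haveI : NumberField ↥ℚ⟮4 * delta W two_ne_zero⟯ := NumberField.mk
  have h2 : Module.finrank ℚ ↥ℚ⟮4 * delta W two_ne_zero⟯ = 2 := finrank_adjoin_eq_two_of_sq_eq (delta_mem_and_sq W).2 hsq
  exact classicalMuVanishes_of_finrank_eq_two _ h2 κk hκk

/-! ## §2 The sign-free `μ`-equivalence: sextic ⟺ cubic -/

/-- ★ **`μ₂ = 0` on the three cubic towers ⟹ `μ₂(ℚ(W[2])^{cyc}) = 0`, BOTH signs** (`W(ℚ)[2] = 0`, `Δ_W ∉ ℚ²`, `2Δ_W ∉ ℚ²`): att-p4 g29's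
`classicalMuVanishes_divisionField_two_of_cubic_of_resolvent_of_not_isSquare` with its resolvent hypothesis `hk` discharged by §1. -/
theorem classicalMuVanishes_divisionField_two_of_cubic_of_not_isSquare (ht : ∀ x : ℚ, ¬ HasRationalTwoTorsionX W x)
    (hsq : ¬ IsSquare W.Δ) (h2Δ : ¬ IsSquare (2 * W.Δ))
    (hK : ∀ j : Fin 3, ∀ κj : ZpExtension ↥ℚ⟮xT W two_ne_zero j⟯ 2, κj.IsCyclotomic → ClassicalMuVanishes κj)
    (κT : ZpExtension (W.divisionField 2) 2) (hκT : κT.IsCyclotomic) : ClassicalMuVanishes κT :=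
  classicalMuVanishes_divisionField_two_of_cubic_of_resolvent_of_not_isSquare W ht hsq h2Δ hK
    (fun κk hκk ↦ classicalMuVanishes_resolvent_of_not_isSquare W hsq κk hκk) κT hκT

/-- ★ **`μ₂ = 0` on ONE cubic tower ⟹ `μ₂(ℚ(W[2])^{cyc}) = 0`, BOTH signs** (one `2`-torsion abscissa `β_j`; the three cubic fields are conjugate,
att-p4 g29's `…SignFreeOneRoot`), resolvent input discharged by §1. -/
theorem classicalMuVanishes_divisionField_two_of_single_cubic_of_not_isSquare (ht : ∀ x : ℚ, ¬ HasRationalTwoTorsionX W x)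
    (hsq : ¬ IsSquare W.Δ) (h2Δ : ¬ IsSquare (2 * W.Δ)) (j : Fin 3)
    (hj : ∀ κj : ZpExtension ↥ℚ⟮xT W two_ne_zero j⟯ 2, κj.IsCyclotomic → ClassicalMuVanishes κj)
    (κT : ZpExtension (W.divisionField 2) 2) (hκT : κT.IsCyclotomic) : ClassicalMuVanishes κT :=
  classicalMuVanishes_divisionField_two_of_single_cubic_of_resolvent W ht hsq h2Δ j hj
    (fun κk hκk ↦ classicalMuVanishes_resolvent_of_not_isSquare W hsq κk hκk) κT hκT

/-- ★★ **`μ₂(ℚ(W[2])^{cyc}) = 0 ⟺ μ₂(ℚ(β_j)^{cyc}) = 0` for all `j` — BOTH SIGNS of `Δ_W`**, for every elliptic `W/ℚ` with no rational `2`-torsion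
abscissa, `Δ_W ∉ ℚ²`, `2Δ_W ∉ ℚ²` (all cyclotomic `ℤ₂`-extensions, growth form): att-p4 g29's `classicalMuVanishes_divisionField_two_iff` with the resolvent
conjunct removed (§1). g29's `…_iff_cubic_of_Δ_neg` is the case `Δ_W < 0`. -/
theorem classicalMuVanishes_divisionField_two_iff_cubic_of_not_isSquare (ht : ∀ x : ℚ, ¬ HasRationalTwoTorsionX W x)
    (hsq : ¬ IsSquare W.Δ) (h2Δ : ¬ IsSquare (2 * W.Δ)) :
    (∀ κT : ZpExtension (W.divisionField 2) 2, κT.IsCyclotomic → ClassicalMuVanishes κT) ↔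
      ∀ j : Fin 3, ∀ κj : ZpExtension ↥ℚ⟮xT W two_ne_zero j⟯ 2, κj.IsCyclotomic → ClassicalMuVanishes κj := by
  rw [classicalMuVanishes_divisionField_two_iff W ht hsq h2Δ]
  exact ⟨fun h ↦ h.1, fun h ↦ ⟨h, fun κk hκk ↦ classicalMuVanishes_resolvent_of_not_isSquare W hsq κk hκk⟩⟩

/-- ★★ **`μ₂(ℚ(W[2])^{cyc}) = 0 ⟺ μ₂(ℚ(β_j)^{cyc}) = 0` for ONE `j` — BOTH SIGNS** (same hypotheses): the sextic datum of the lead's criterion and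
the cubic datum of ONE point field are the same Iwasawa statement, on the whole `S₃` locus. -/
theorem classicalMuVanishes_divisionField_two_iff_single_cubic_of_not_isSquare (ht : ∀ x : ℚ, ¬ HasRationalTwoTorsionX W x)
    (hsq : ¬ IsSquare W.Δ) (h2Δ : ¬ IsSquare (2 * W.Δ)) (j : Fin 3) :
    (∀ κT : ZpExtension (W.divisionField 2) 2, κT.IsCyclotomic → ClassicalMuVanishes κT) ↔
      ∀ κj : ZpExtension ↥ℚ⟮xT W two_ne_zero j⟯ 2, κj.IsCyclotomic → ClassicalMuVanishes κj :=
  ⟨fun hT κj hκj ↦ classicalMuVanishes_cubic_of_divisionField_two W hT j κj hκj,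
    fun hj κT hκT ↦ classicalMuVanishes_divisionField_two_of_single_cubic_of_not_isSquare W ht hsq h2Δ j hj κT hκT⟩

/-! ## §3 On C2's own binders -/

/-- **`μ₂(ℚ(√Δ_W)^{cyc}) = 0` on the crux's domain** (indeed for every `W` with `Δ_W ∉ ℚ²`; stated with C2's binders for the ledger). -/
theorem classicalMuVanishes_resolvent_of_isOrdinaryAt [W.IsGloballyMinimal] (_hord : IsOrdinaryAt W 2) (hsq : ¬ IsSquare W.Δ)
    (κk : ZpExtension ↥ℚ⟮4 * delta W two_ne_zero⟯ 2) (hκk : κk.IsCyclotomic) : ClassicalMuVanishes κk :=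
  classicalMuVanishes_resolvent_of_not_isSquare W hsq κk hκk

/-- ★ **On the crux's ENTIRE domain** (`W` globally minimal, good ordinary at `2`, no rational `2`-torsion abscissa, `Δ_W ∉ ℚ²`; BOTH signs):
`μ₂ = 0` along the cyclotomic `ℤ₂`-tower of ONE cubic point field `ℚ(β_j)` ⟹ `μ₂(ℚ(W[2])^{cyc}) = 0` (Lim's carrier / the middle field of the registered
stub PFμ⁺). `2Δ_W ∉ ℚ²` by att-p4 g29's `not_isSquare_two_mul_Δ_of_isOrdinaryAt`. Nothing closed. -/
theorem classicalMuVanishes_divisionField_two_of_single_cubic_of_isOrdinaryAt [W.IsGloballyMinimal] (hord : IsOrdinaryAt W 2)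
    (ht : ∀ x : ℚ, ¬ HasRationalTwoTorsionX W x) (hsq : ¬ IsSquare W.Δ) (j : Fin 3)
    (hj : ∀ κj : ZpExtension ↥ℚ⟮xT W two_ne_zero j⟯ 2, κj.IsCyclotomic → ClassicalMuVanishes κj)
    (κT : ZpExtension (W.divisionField 2) 2) (hκT : κT.IsCyclotomic) : ClassicalMuVanishes κT :=
  classicalMuVanishes_divisionField_two_of_single_cubic_of_not_isSquare W ht hsq (not_isSquare_two_mul_Δ_of_isOrdinaryAt W hord) j hj κT hκT

/-- ★★ **On the crux's ENTIRE domain, BOTH signs: `μ₂(ℚ(W[2])^{cyc}) = 0 ⟺ μ₂(ℚ(β_j)^{cyc}) = 0` for one (equivalently every) `j`** — the C2 input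
ledger's sextic and cubic `μ`-currencies coincide by theorem, with NO resolvent datum and NO sign condition. -/
theorem classicalMuVanishes_divisionField_two_iff_single_cubic_of_isOrdinaryAt [W.IsGloballyMinimal] (hord : IsOrdinaryAt W 2)
    (ht : ∀ x : ℚ, ¬ HasRationalTwoTorsionX W x) (hsq : ¬ IsSquare W.Δ) (j : Fin 3) :
    (∀ κT : ZpExtension (W.divisionField 2) 2, κT.IsCyclotomic → ClassicalMuVanishes κT) ↔
      ∀ κj : ZpExtension ↥ℚ⟮xT W two_ne_zero j⟯ 2, κj.IsCyclotomic → ClassicalMuVanishes κj :=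
  classicalMuVanishes_divisionField_two_iff_single_cubic_of_not_isSquare W ht hsq (not_isSquare_two_mul_Δ_of_isOrdinaryAt W hord) j

/-! ## §4 The `S₃` Kuroda `λ`-identity, sign-free -/

/-- ★ **A sign-free `S₃`-pair for `Gal(T/ℚ)`, `T = ℚ(W[2])`** (`W(ℚ)[2] = 0`, `Δ_W ∉ ℚ²`): `σ` of order `3` generating the fixing subgroup of the
resolvent `ℚ(δ) ⊆ T`, `τ` of order `2` generating the fixing subgroup of the cubic `ℚ(β_j) ⊆ T`, `τσ = σ²τ`, `⟨σ, τ⟩ = Gal(T/ℚ)` — g33's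
`exists_symmetricThree_gal` with `Δ_W < 0` replaced by `Δ_W ∉ ℚ²` (att-p4 g29's sign-free subgroup data). -/
theorem exists_symmetricThree_gal_of_not_isSquare (ht : ∀ x : ℚ, ¬ HasRationalTwoTorsionX W x) (hsq : ¬ IsSquare W.Δ) (j : Fin 3) :
    haveI : IsGalois ℚ (W.divisionField 2) := W.isGalois_divisionField 2
    ∃ σ τ : W.divisionField 2 ≃ₐ[ℚ] W.divisionField 2,
      Subgroup.zpowers σ = (ℚ⟮(⟨4 * delta W two_ne_zero, (delta_mem_and_sq W).1⟩ : W.divisionField 2)⟯).fixingSubgroup ∧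
      Subgroup.zpowers τ = (ℚ⟮(⟨xT W two_ne_zero j, xT_mem W j⟩ : W.divisionField 2)⟯).fixingSubgroup ∧
      σ ^ 3 = 1 ∧ τ ^ 2 = 1 ∧ τ * σ = σ ^ 2 * τ ∧
      Subgroup.closure ({σ, τ} : Set (W.divisionField 2 ≃ₐ[ℚ] W.divisionField 2)) = ⊤ := by
  haveI : IsGalois ℚ (W.divisionField 2) := W.isGalois_divisionField 2
  have hj : j ≠ j + 1 := by fin_cases j <;> decide
  exact exists_symmetricThree_generators (natCard_gal_of_not_isSquare W ht hsq) _ _ _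
    (natCard_fixingSubgroup_adjoin_delta_of_not_isSquare W ht hsq) (natCard_fixingSubgroup_adjoin_xT_of_not_isSquare W ht hsq j)
    (natCard_fixingSubgroup_adjoin_xT_of_not_isSquare W ht hsq (j + 1)) (fixingSubgroup_adjoin_xT_ne_of_not_isSquare W ht hsq hj)

/-- ★★ **THE `S₃` KURODA `λ`-IDENTITY, SIGN-FREE: `λ₂(ℚ(W[2])) = λ₂(ℚ(√Δ_W)) + 2·λ₂(ℚ(β))`.** `W/ℚ` elliptic with no rational `2`-torsion abscissa,
`Δ_W ∉ ℚ²`, `2Δ_W ∉ ℚ²` (BOTH signs); `κT`, `κK`, `κk` ANY cyclotomic `ℤ₂`-extensions of `T = ℚ(W[2])`, of the resolvent model `ℚ(4δ₀)` and of the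
cubic model `ℚ(β_j)`. If `μ₂ = 0` (growth form) along the cyclotomic `ℤ₂`-tower of ONE cubic field `ℚ(β_i)`, then
**`classicalLambda κT = classicalLambda κK + 2 · classicalLambda κk`**. g33's `Δ_W < 0` theorem made sign-free: the `μ`-inputs on the resolvent
(`classicalMuVanishes_of_finrank_eq_two`, this seat) and on `T` (att-p4 g29's sign-free descent) are theorems, the `S₃`-pair is §4's, `T ∩ ℚ_∞ = ℚ` and
`ℚ(δ) ∩ ℚ_∞ = ℚ` are g29's sign-free surjectivities, and the relation itself is the Literature `classicalLambda_symmetricThree` over the layers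
`ℚ_n` (odd class numbers). Conditional only on the displayed cubic `μ`-input; BSD is not proved by any of this. -/
theorem classicalLambda_divisionField_two_eq_resolvent_add_two_mul_cubic_of_not_isSquare (ht : ∀ x : ℚ, ¬ HasRationalTwoTorsionX W x)
    (hsq : ¬ IsSquare W.Δ) (h2Δ : ¬ IsSquare (2 * W.Δ)) (i : Fin 3)
    (hμi : ∀ κi : ZpExtension ↥ℚ⟮xT W two_ne_zero i⟯ 2, κi.IsCyclotomic → ClassicalMuVanishes κi)
    (j : Fin 3) (κT : ZpExtension (W.divisionField 2) 2) (hκT : κT.IsCyclotomic)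
    (κK : ZpExtension ↥ℚ⟮4 * delta W two_ne_zero⟯ 2) (hκK : κK.IsCyclotomic)
    (κk : ZpExtension ↥ℚ⟮xT W two_ne_zero j⟯ 2) (hκk : κk.IsCyclotomic) :
    classicalLambda κT = classicalLambda κK + 2 * classicalLambda κk := by
  haveI : NumberField (W.divisionField 2) := NumberField.mk
  haveI : IsGalois ℚ (W.divisionField 2) := W.isGalois_divisionField 2
  haveI : ∀ i : Fin 3, FiniteDimensional ℚ ↥ℚ⟮xT W two_ne_zero i⟯ := fun i ↦
    IntermediateField.adjoin.finiteDimensional ((AlgebraicClosure.isAlgebraic ℚ).isAlgebraic _).isIntegral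
  haveI : ∀ i : Fin 3, NumberField ↥ℚ⟮xT W two_ne_zero i⟯ := fun i ↦ NumberField.mk
  haveI : FiniteDimensional ℚ ↥ℚ⟮4 * delta W two_ne_zero⟯ :=
    IntermediateField.adjoin.finiteDimensional ((AlgebraicClosure.isAlgebraic ℚ).isAlgebraic _).isIntegral
  haveI : NumberField ↥ℚ⟮4 * delta W two_ne_zero⟯ := NumberField.mk
  -- `μ₂ = 0` on all three cubic towers from the one given
  have hμ3 : ∀ i' : Fin 3, ∀ κi' : ZpExtension ↥ℚ⟮xT W two_ne_zero i'⟯ 2, κi'.IsCyclotomic → ClassicalMuVanishes κi' := by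
    intro i' κi' hκi'
    obtain ⟨κi, hκi⟩ := exists_cyclotomicZpExtension_holds ↥ℚ⟮xT W two_ne_zero i⟯ 2
    exact classicalMuVanishes_cubic_of_cubic W ht i i' κi hκi (hμi κi hκi) κi' hκi'
  obtain ⟨κ, hκ⟩ := exists_cyclotomicZpExtension_holds ℚ 2
  have hL := surjective_gal_restrict_of_not_isSquare W ht hsq h2Δ κ hκ
  obtain ⟨σ, τ, hσC, hτH, hσ3, hτ2, hτσ, hgen⟩ := exists_symmetricThree_gal_of_not_isSquare W ht hsq j
  haveI : ∀ E : IntermediateField ℚ (W.divisionField 2), NumberField ↥E := fun E ↦ NumberField.mk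
  have hK := surjective_comp_absGaloisRestrict_of_tower κ ↥(fixedField (Subgroup.zpowers σ)) (W.divisionField 2) hL
  have hk := surjective_comp_absGaloisRestrict_of_tower κ ↥(fixedField (Subgroup.zpowers τ)) (W.divisionField 2) hL
  have hK' := surjective_resolvent_restrict_of_not_isSquare W hsq h2Δ κ hκ
  have hk' : ∀ i : Fin 3, Function.Surjective (κ.toContinuousMonoidHom.comp (absGaloisRestrict ℚ ↥ℚ⟮xT W two_ne_zero i⟯)) :=
    fun i ↦ surjective_cubic_restrict W ht κ i
  -- models of the two fixed fields
  obtain ⟨φK₀⟩ := nonempty_algEquiv_fixedField_resolvent W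
  obtain ⟨φk₀⟩ := nonempty_algEquiv_fixedField_cubic W j
  have φK : ↥(fixedField (Subgroup.zpowers σ)) ≃ₐ[ℚ] ↥ℚ⟮4 * delta W two_ne_zero⟯ :=
    (IntermediateField.equivOfEq (by rw [hσC])).trans φK₀
  have φk : ↥(fixedField (Subgroup.zpowers τ)) ≃ₐ[ℚ] ↥ℚ⟮xT W two_ne_zero j⟯ :=
    (IntermediateField.equivOfEq (by rw [hτH])).trans φk₀
  -- `μ = 0` inputs: cubic (hypothesis), resolvent (quadratic, this seat), sextic (att-p4's sign-free descent)
  have hμKall : ∀ κk' : ZpExtension ↥ℚ⟮4 * delta W two_ne_zero⟯ 2, κk'.IsCyclotomic → ClassicalMuVanishes κk' :=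
    fun κk' hk'' ↦ classicalMuVanishes_resolvent_of_not_isSquare W hsq κk' hk''
  have hμK : ClassicalMuVanishes (κ.restrict ↥(fixedField (Subgroup.zpowers σ)) hK) :=
    (classicalMuVanishes_restrict_iff_of_algEquiv κ φK hK hK').mpr (hμKall _ (isCyclotomic_restrict κ hκ _ hK'))
  have hμk : ClassicalMuVanishes (κ.restrict ↥(fixedField (Subgroup.zpowers τ)) hk) :=
    (classicalMuVanishes_restrict_iff_of_algEquiv κ φk hk (hk' j)).mpr (hμ3 j _ (isCyclotomic_restrict κ hκ _ (hk' j)))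
  have hμT : ClassicalMuVanishes (κ.restrict (W.divisionField 2) hL) :=
    classicalMuVanishes_divisionField_two_of_cubic_of_resolvent_of_not_isSquare W ht hsq h2Δ hμ3 hμKall
      (κ.restrict (W.divisionField 2) hL) (isCyclotomic_restrict κ hκ (W.divisionField 2) hL)
  -- odd class numbers of the layers `ℚ_n`
  have hF : ∀ (hT : Function.Surjective (κ.toContinuousMonoidHom.comp
      (absGaloisRestrict ℚ ↥(fixedField (⊤ : Subgroup (W.divisionField 2 ≃ₐ[ℚ] W.divisionField 2)))))) (n : ℕ),
      classNumberPExp (κ.restrict ↥(fixedField (⊤ : Subgroup (W.divisionField 2 ≃ₐ[ℚ] W.divisionField 2))) hT) n = 0 := by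
    intro hT n
    obtain ⟨φ⟩ := nonempty_algEquiv_fixedField_top W
    have h' : Function.Surjective (κ.toContinuousMonoidHom.comp (absGaloisRestrict ℚ ℚ)) :=
      surjective_comp_absGaloisRestrict_of_not_dvd_finrank κ ℚ (by rw [Module.finrank_self]; decide)
    rw [classNumberPExp_restrict_eq_of_algEquiv κ φ hT h' n]
    exact classNumberPExp_rat_eq_zero _ n
  have h4 : ¬ 4 ∣ Module.finrank ℚ (W.divisionField 2) := by rw [finrank_divisionField_two_eq_six W ht hsq]; decide
  -- the `S₃` relation for `λ` along `κ`, then transport to the given towers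
  have main := classicalLambda_symmetricThree κ (W.divisionField 2) hL hσ3 hτ2 hτσ hgen h4 hK hk hF hμT hμK hμk
  rw [classicalLambda_eq_of_isCyclotomic κT (κ.restrict (W.divisionField 2) hL) hκT
      (isCyclotomic_restrict κ hκ (W.divisionField 2) hL),
    classicalLambda_eq_of_isCyclotomic κK (κ.restrict _ hK') hκK (isCyclotomic_restrict κ hκ _ hK'),
    classicalLambda_eq_of_isCyclotomic κk (κ.restrict _ (hk' j)) hκk (isCyclotomic_restrict κ hκ _ (hk' j)),
    ← classicalLambda_restrict_eq_of_algEquiv κ φK hK hK', ← classicalLambda_restrict_eq_of_algEquiv κ φk hk (hk' j)]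
  exact main

/-- ★ **The sign-free `λ`-identity on the crux's binders** (`W` globally minimal, good ordinary at `2`, no rational `2`-torsion abscissa, `Δ_W ∉ ℚ²`;
BOTH signs): `μ₂(ℚ(β_i)^{cyc}) = 0` for one `i` ⟹ `λ₂(ℚ(W[2])) = λ₂(ℚ(√Δ_W)) + 2·λ₂(ℚ(β_j))` (any cyclotomic towers). On `Δ_W > 0` the three fields
are totally real (Greenberg's conjecture territory); nothing about the values is claimed. -/
theorem classicalLambda_divisionField_two_eq_resolvent_add_two_mul_cubic_of_isOrdinaryAt [W.IsGloballyMinimal] (hord : IsOrdinaryAt W 2)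
    (ht : ∀ x : ℚ, ¬ HasRationalTwoTorsionX W x) (hsq : ¬ IsSquare W.Δ) (i : Fin 3)
    (hμi : ∀ κi : ZpExtension ↥ℚ⟮xT W two_ne_zero i⟯ 2, κi.IsCyclotomic → ClassicalMuVanishes κi)
    (j : Fin 3) (κT : ZpExtension (W.divisionField 2) 2) (hκT : κT.IsCyclotomic)
    (κK : ZpExtension ↥ℚ⟮4 * delta W two_ne_zero⟯ 2) (hκK : κK.IsCyclotomic)
    (κk : ZpExtension ↥ℚ⟮xT W two_ne_zero j⟯ 2) (hκk : κk.IsCyclotomic) :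
    classicalLambda κT = classicalLambda κK + 2 * classicalLambda κk :=
  classicalLambda_divisionField_two_eq_resolvent_add_two_mul_cubic_of_not_isSquare W ht hsq (not_isSquare_two_mul_Δ_of_isOrdinaryAt W hord)
    i hμi j κT hκT κK hκK κk hκk

end Summit.BirchSwinnertonDyer.BirchSwinnertonDyer.Theorems.AlignedTransportAtTwoResolventMuUnconditional

end
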